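import Summits.ValiantsHypothesis.ValiantsHypothesis.Theorems.LacunarySymmetroidMatrixDescartesCensusPivotTwoDescartes
import Summits.ValiantsHypothesis.ValiantsHypothesis.Theorems.LacunarySymmetroidMatrixDescartesCensusLaguerreSum

/-!
# `MatrixDescartes` (stmt-ValiantsHypothesis-18050) — CLUSTERED NEGATIVE SIGN BUDGETS for Descartes' rule
# (toolkit for the W-law chamber law at `n = 2`, file `…WLawTwoChambers`)

HONEST FRAMING.  Cell `pub-symmetroid`, seat `val-sym-mdr-p1` (gen 4); helper `--supports` the crux
`Theses.LacunarySymmetroid.MatrixDescartes` (OPEN), NO closure claim.  Elementary theorems about ONE real polynomial: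

* `signVariations_twoEnded_budget` — `Var(P) + [lead P < 0] + [lowest coefficient < 0] ≤ 2 · #negSupp P`
  (two-ended form of the tree's `Pivot.TwoDescartes.signVariations_add_le_two_mul_card_negSupp`);
* `split_at_pair` — if `P.coeff u < 0`, `P.coeff v < 0` (`u < v`) and all coefficients strictly between vanish, then
  `P = A + X^v B` with `Var(P) = Var(A) + Var(B)` (tree splitting lemma `Census.signVariations_add_X_pow_mul`);
* `signVariations_pair_budget` — negative coefficients confined to `T`, two members `u < v` of `T` with only zero
  coefficients strictly between: `Var(P) + [lead P < 0] + 2 ≤ 2·#T`;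
* `signVariations_two_pairs_budget` — two disjoint such pairs: `Var(P) + [lead P < 0] + 4 ≤ 2·#T`;
* `card_posRoots_le_signVariations` — distinct positive roots `≤ Var` (Mathlib's Descartes rule).

Nothing here bears on `MatrixDescartes`, `WLaw`, `DoorA26`/`DoorA34` or `VP ≠ VNP`.

[folklore] Descartes' rule of signs (Mathlib `Polynomial.roots_countP_pos_le_signVariations`) with sign bookkeeping; no source.
-/

-- `Summit.ValiantsHypothesis.ValiantsHypothesis.…` repeats a component by the D-0017 layout
-- (single-conjunct summit), which the `dupNamespace` linter flags; the name is mandated.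
set_option linter.dupNamespace false

namespace Summit.ValiantsHypothesis.ValiantsHypothesis.Theorems.LacunarySymmetroidMatrixDescartes

open Polynomial Finset
open scoped BigOperators

namespace WLawTwoChambers

open Pivot.TwoDescartes (negSupp)

/-! ## 1. Sign-variation budgets with clustered negative coefficients -/

/-- **Two-ended budget** (index form): if all coefficients of `P` below `t` vanish and `P.coeff t < 0`, then
`Var(P) + [lead P < 0] + 1 ≤ 2 · #negSupp P`. [folklore] -/
theorem signVariations_twoEnded_budget (N : ℕ) :
    ∀ (P : ℝ[X]) (t : ℕ), P.support.card ≤ N → (∀ m < t, P.coeff m = 0) → P.coeff t < 0 →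
      P.signVariations + (if P.leadingCoeff < 0 then 1 else 0) + 1 ≤ 2 * (negSupp P).card := by
  induction N with
  | zero =>
    intro P t hP _ ht
    have hP0 : P = 0 := Polynomial.support_eq_empty.mp (Finset.card_eq_zero.mp (Nat.le_zero.mp hP))
    rw [hP0, coeff_zero] at ht
    exact absurd ht (lt_irrefl 0)
  | succ N ih =>
    intro P t hP hlow ht
    have hP0 : P ≠ 0 := fun h => by rw [h, coeff_zero] at ht; exact lt_irrefl _ ht
    have htdeg : t ≤ P.natDegree := le_natDegree_of_ne_zero ht.ne
    have htmem : t ∈ negSupp P := by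
      simp only [negSupp, Finset.mem_filter, mem_support_iff]
      exact ⟨ht.ne, ht⟩
    by_cases hE : P.eraseLead = 0
    · -- `P` is a monomial, necessarily at `t`
      have htd : t = P.natDegree := by
        by_contra hne
        exact ht.ne (by rw [← eraseLead_coeff_of_ne t hne, hE, coeff_zero])
      have hmono : P = monomial P.natDegree P.leadingCoeff := by
        conv_lhs => rw [← eraseLead_add_monomial_natDegree_leadingCoeff P, hE, zero_add]
      have hsv : P.signVariations = 0 := by rw [hmono, signVariations_monomial]
      have hlc : P.leadingCoeff < 0 := by rw [leadingCoeff, ← htd]; exact ht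
      have hcard : 1 ≤ (negSupp P).card := Finset.card_pos.mpr ⟨t, htmem⟩
      rw [hsv, if_pos hlc]
      omega
    · have hlt := eraseLead_support_card_lt hP0
      have htd : t ≠ P.natDegree := by
        intro htd
        apply hE
        rw [← card_support_eq_zero, ← Nat.lt_one_iff]
        have hsub : P.eraseLead.support ⊆ {P.natDegree} := by
          intro m hm
          rw [eraseLead_support, Finset.mem_erase] at hm
          rw [Finset.mem_singleton]
          by_contra hne
          have hle : m ≤ P.natDegree := le_natDegree_of_mem_supp m hm.2
          have hml : m < t := by omega
          exact (mem_support_iff.mp hm.2) (hlow m hml)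
        have := Finset.card_le_card hsub
        rw [Finset.card_singleton] at this
        have hne : P.eraseLead.support ≠ {P.natDegree} := by
          intro h
          have : P.natDegree ∈ P.eraseLead.support := by rw [h]; exact Finset.mem_singleton_self _
          rw [eraseLead_support] at this
          exact Finset.notMem_erase _ _ this
        rcases Nat.lt_or_ge P.eraseLead.support.card 1 with h1 | h1
        · exact h1
        · exfalso
          exact hne (Finset.eq_of_subset_of_card_le hsub (by rw [Finset.card_singleton]; exact h1))
      have hEt : P.eraseLead.coeff t = P.coeff t := eraseLead_coeff_of_ne t htd
      have hElow : ∀ m < t, P.eraseLead.coeff m = 0 := fun m hm => by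
        rw [eraseLead_coeff_of_ne m (by omega)]; exact hlow m hm
      have ihE := ih P.eraseLead t (by omega) hElow (by rw [hEt]; exact ht)
      have hcount := Pivot.TwoDescartes.card_negSupp_eraseLead_add P hP0
      rw [signVariations_eq_eraseLead_add_ite hP0]
      have hlc : P.leadingCoeff ≠ 0 := fun h => hP0 (leadingCoeff_eq_zero.mp h)
      have key : SignType.sign P.leadingCoeff = -SignType.sign P.eraseLead.leadingCoeff →
          P.leadingCoeff < 0 ∨ P.eraseLead.leadingCoeff < 0 := by
        intro hs
        rcases lt_or_gt_of_ne hlc with h | h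
        · exact Or.inl h
        · right
          rw [sign_pos h] at hs
          rcases lt_trichotomy P.eraseLead.leadingCoeff 0 with h' | h' | h'
          · exact h'
          · rw [h', sign_zero] at hs; exact absurd hs (by decide)
          · rw [sign_pos h'] at hs; exact absurd hs (by decide)
      by_cases hs : SignType.sign P.leadingCoeff = -SignType.sign P.eraseLead.leadingCoeff
      · rw [if_pos hs]
        rcases key hs with h | h
        · rw [if_pos h] at hcount ⊢
          by_cases h' : P.eraseLead.leadingCoeff < 0
          · rw [if_pos h'] at ihE; omega
          · rw [if_neg h'] at ihE; omega
        · rw [if_pos h] at ihE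
          by_cases h' : P.leadingCoeff < 0
          · rw [if_pos h'] at hcount ⊢; omega
          · rw [if_neg h'] at hcount ⊢; omega
      · rw [if_neg hs]
        by_cases h' : P.leadingCoeff < 0
        · rw [if_pos h'] at hcount ⊢
          by_cases h'' : P.eraseLead.leadingCoeff < 0
          · rw [if_pos h''] at ihE; omega
          · rw [if_neg h''] at ihE; omega
        · rw [if_neg h'] at hcount ⊢
          by_cases h'' : P.eraseLead.leadingCoeff < 0
          · rw [if_pos h''] at ihE; omega
          · rw [if_neg h''] at ihE; omega

/-- The plain budget in `T`-form: if every negative coefficient sits in `T` then `Var(P) + [lead P < 0] ≤ 2·#T`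
(tree `Pivot.TwoDescartes.signVariations_add_le_two_mul_card_negSupp`). [folklore] -/
theorem signVariations_budget (P : ℝ[X]) (T : Finset ℕ) (hT : ∀ n, P.coeff n < 0 → n ∈ T) :
    P.signVariations + (if P.leadingCoeff < 0 then 1 else 0) ≤ 2 * T.card := by
  have h1 := Pivot.TwoDescartes.signVariations_add_le_two_mul_card_negSupp P
  have h2 : (negSupp P).card ≤ T.card := by
    refine Finset.card_le_card fun n hn => ?_
    simp only [negSupp, Finset.mem_filter] at hn
    exact hT n hn.2
  omega

/-- **Splitting at an adjacent negative pair.**  If `P.coeff u < 0`, `P.coeff v < 0` (`u < v`) and every coefficient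
strictly between vanishes, then `P = A + X^v·B` with `A = ` the part of degree `≤ u` and `B` the part from `v` on, and
`Var(P) = Var(A) + Var(B)` (no variation at the junction of two negative coefficients). [folklore] -/
theorem split_at_pair (P : ℝ[X]) (u v : ℕ) (huv : u < v) (ha : P.coeff u < 0) (hb : P.coeff v < 0)
    (hgap : ∀ m, u < m → m < v → P.coeff m = 0) :
    ∃ A B : ℝ[X], (∀ n, A.coeff n = if n < u + 1 then P.coeff n else 0) ∧ (∀ n, B.coeff n < 0 → P.coeff (v + n) < 0) ∧
      A.leadingCoeff = P.coeff u ∧ B.coeff 0 = P.coeff v ∧ P.leadingCoeff = B.leadingCoeff ∧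
      B.support.card ≤ P.support.card ∧
      P.signVariations = A.signVariations + B.signVariations := by
  set A : ℝ[X] := ∑ m ∈ range (u + 1), C (P.coeff m) * X ^ m with hA
  set B : ℝ[X] := ∑ m ∈ range (P.natDegree + 1), C (P.coeff (v + m)) * X ^ m with hB
  have hAc : ∀ n, A.coeff n = if n < u + 1 then P.coeff n else 0 := fun n => Census.coeff_sum_C_mul_X_pow _ _ n
  have hBc : ∀ n, B.coeff n = if n < P.natDegree + 1 then P.coeff (v + n) else 0 :=
    fun n => Census.coeff_sum_C_mul_X_pow _ _ n
  have hBc' : ∀ n, B.coeff n = P.coeff (v + n) := by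
    intro n
    rw [hBc]
    split_ifs with h
    · rfl
    · exact (coeff_eq_zero_of_natDegree_lt (by omega)).symm
  have hPAB : P = A + X ^ v * B := by
    ext i
    rw [coeff_add, coeff_X_pow_mul', hAc, hBc']
    by_cases h1 : i < u + 1
    · rw [if_pos h1, if_neg (by omega), add_zero]
    · rw [if_neg h1, zero_add]
      by_cases h2 : v ≤ i
      · rw [if_pos h2, Nat.add_sub_cancel' h2]
      · rw [if_neg h2]
        exact hgap i (by omega) (by omega)
  have hAu : A.coeff u = P.coeff u := by rw [hAc, if_pos (Nat.lt_succ_self u)]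
  have hA0 : A ≠ 0 := fun h => ha.ne (by rw [← hAu, h, coeff_zero])
  have hAdeg : A.natDegree = u := by
    refine le_antisymm ?_ (le_natDegree_of_ne_zero (by rw [hAu]; exact ha.ne))
    exact natDegree_le_iff_coeff_eq_zero.mpr fun m hm => by rw [hAc, if_neg (by omega)]
  have hAlead : A.leadingCoeff = P.coeff u := by rw [leadingCoeff, hAdeg, hAu]
  have hB0c : B.coeff 0 = P.coeff v := by rw [hBc', add_zero]
  have hB0 : B ≠ 0 := fun h => hb.ne (by rw [← hB0c, h, coeff_zero])
  have hXB0 : X ^ v * B ≠ 0 := mul_ne_zero (pow_ne_zero _ X_ne_zero) hB0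
  have hdeglt : A.degree < (X ^ v * B).degree := by
    rw [degree_eq_natDegree hA0, degree_eq_natDegree hXB0, hAdeg, natDegree_X_pow_mul v hB0]
    exact_mod_cast (show u < B.natDegree + v by omega)
  have hPlead : P.leadingCoeff = B.leadingCoeff := by
    rw [hPAB, leadingCoeff_add_of_degree_lt hdeglt, mul_comm, leadingCoeff_mul_X_pow]
  have hBsupp : B.support.card ≤ P.support.card := by
    refine Finset.card_le_card_of_injOn (fun n => v + n) (fun n hn => ?_) (fun a _ b _ hab => by
      simpa using hab)
    rw [Finset.mem_coe, mem_support_iff] at hn ⊢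
    rwa [← hBc']
  have hsplit := Census.signVariations_add_X_pow_mul (B.support.card) A B v 0 rfl hA0 (by rw [hAdeg]; exact huv)
    hB0 (fun m hm => absurd hm (Nat.not_lt_zero m)) (by rw [hB0c]; exact hb.ne)
  have hjunction : ¬ SignType.sign A.leadingCoeff = -SignType.sign (B.coeff 0) := by
    rw [hAlead, hB0c, sign_neg ha, sign_neg hb]
    decide
  rw [if_neg hjunction, add_zero, ← hPAB] at hsplit
  refine ⟨A, B, hAc, fun n hn => ?_, hAlead, hB0c, hPlead, hBsupp, hsplit⟩
  rwa [← hBc']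

/-- **Pair budget.**  Negative coefficients confined to `T`, and two members `u < v` of `T` with only zero coefficients
strictly between them: `Var(P) + [lead P < 0] + 2 ≤ 2·#T`. [folklore] -/
theorem signVariations_pair_budget (P : ℝ[X]) (T : Finset ℕ) (hT : ∀ n, P.coeff n < 0 → n ∈ T)
    (u v : ℕ) (huv : u < v) (hu : u ∈ T) (hv : v ∈ T) (hgap : ∀ m, u < m → m < v → P.coeff m = 0) :
    P.signVariations + (if P.leadingCoeff < 0 then 1 else 0) + 2 ≤ 2 * T.card := by
  by_cases ha : P.coeff u < 0
  swap
  · -- `u` carries no negative coefficient: budget on `T.erase u`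
    have hT' : ∀ n, P.coeff n < 0 → n ∈ T.erase u := fun n hn =>
      Finset.mem_erase.mpr ⟨fun h => ha (h ▸ hn), hT n hn⟩
    have h1 := signVariations_budget P _ hT'
    rw [Finset.card_erase_of_mem hu] at h1
    have : 1 ≤ T.card := Finset.card_pos.mpr ⟨u, hu⟩
    omega
  by_cases hb : P.coeff v < 0
  swap
  · have hT' : ∀ n, P.coeff n < 0 → n ∈ T.erase v := fun n hn =>
      Finset.mem_erase.mpr ⟨fun h => hb (h ▸ hn), hT n hn⟩
    have h1 := signVariations_budget P _ hT'
    rw [Finset.card_erase_of_mem hv] at h1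
    have : 1 ≤ T.card := Finset.card_pos.mpr ⟨v, hv⟩
    omega
  obtain ⟨A, B, hAc, hBneg, hAlead, hB0c, hPlead, hBsupp, hsplit⟩ := split_at_pair P u v huv ha hb hgap
  -- budget of `A` (leading coefficient `P.coeff u < 0`) inside `T ∩ [0,u]`
  have hTA : ∀ n, A.coeff n < 0 → n ∈ T.filter (fun n => n ≤ u) := by
    intro n hn
    rw [hAc] at hn
    split_ifs at hn with h
    · exact Finset.mem_filter.mpr ⟨hT n hn, by omega⟩
    · exact absurd hn (lt_irrefl 0)
  have hA1 := signVariations_budget A _ hTA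
  rw [hAlead, if_pos ha] at hA1
  -- two-ended budget of `B` (constant coefficient `P.coeff v < 0`) inside `T ∩ [v,∞)`
  have hB1 := signVariations_twoEnded_budget _ B 0 le_rfl (fun m hm => absurd hm (Nat.not_lt_zero m))
    (by rw [hB0c]; exact hb)
  have hB2 : (negSupp B).card ≤ (T.filter (fun n => ¬ n ≤ u)).card := by
    refine Finset.card_le_card_of_injOn (fun n => v + n) (fun n hn => ?_) (fun a _ b _ hab => by simpa using hab)
    rw [Finset.mem_coe] at hn
    simp only [negSupp, Finset.mem_filter] at hn
    rw [Finset.mem_coe, Finset.mem_filter]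
    exact ⟨hT _ (hBneg n hn.2), by dsimp only; omega⟩
  have hsum : (T.filter (fun n => n ≤ u)).card + (T.filter (fun n => ¬ n ≤ u)).card = T.card :=
    Finset.card_filter_add_card_filter_not _
  rw [hsplit, hPlead]
  omega

/-- **Two-pairs budget.**  As `signVariations_pair_budget`, with two disjoint adjacent pairs `u₁ < v₁ < u₂ < v₂`
of `T`: `Var(P) + [lead P < 0] + 4 ≤ 2·#T`. [folklore] -/
theorem signVariations_two_pairs_budget (P : ℝ[X]) (T : Finset ℕ) (hT : ∀ n, P.coeff n < 0 → n ∈ T)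
    (u₁ v₁ u₂ v₂ : ℕ) (h₁ : u₁ < v₁) (h₁₂ : v₁ < u₂) (h₂ : u₂ < v₂)
    (hu₁ : u₁ ∈ T) (hv₁ : v₁ ∈ T) (hu₂ : u₂ ∈ T) (hv₂ : v₂ ∈ T)
    (hgap₁ : ∀ m, u₁ < m → m < v₁ → P.coeff m = 0) (hgap₂ : ∀ m, u₂ < m → m < v₂ → P.coeff m = 0) :
    P.signVariations + (if P.leadingCoeff < 0 then 1 else 0) + 4 ≤ 2 * T.card := by
  by_cases ha : P.coeff u₂ < 0
  swap
  · have hT' : ∀ n, P.coeff n < 0 → n ∈ T.erase u₂ := fun n hn =>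
      Finset.mem_erase.mpr ⟨fun h => ha (h ▸ hn), hT n hn⟩
    have h1 := signVariations_pair_budget P _ hT' u₁ v₁ h₁
      (Finset.mem_erase.mpr ⟨by omega, hu₁⟩) (Finset.mem_erase.mpr ⟨by omega, hv₁⟩) hgap₁
    rw [Finset.card_erase_of_mem hu₂] at h1
    have : 1 ≤ T.card := Finset.card_pos.mpr ⟨u₂, hu₂⟩
    omega
  by_cases hb : P.coeff v₂ < 0
  swap
  · have hT' : ∀ n, P.coeff n < 0 → n ∈ T.erase v₂ := fun n hn =>
      Finset.mem_erase.mpr ⟨fun h => hb (h ▸ hn), hT n hn⟩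
    have h1 := signVariations_pair_budget P _ hT' u₁ v₁ h₁
      (Finset.mem_erase.mpr ⟨by omega, hu₁⟩) (Finset.mem_erase.mpr ⟨by omega, hv₁⟩) hgap₁
    rw [Finset.card_erase_of_mem hv₂] at h1
    have : 1 ≤ T.card := Finset.card_pos.mpr ⟨v₂, hv₂⟩
    omega
  obtain ⟨A, B, hAc, hBneg, hAlead, hB0c, hPlead, hBsupp, hsplit⟩ := split_at_pair P u₂ v₂ h₂ ha hb hgap₂
  -- pair budget of `A` inside `T ∩ [0,u₂]` (it contains the first pair and has leading coefficient `P.coeff u₂ < 0`)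
  have hTA : ∀ n, A.coeff n < 0 → n ∈ T.filter (fun n => n ≤ u₂) := by
    intro n hn
    rw [hAc] at hn
    split_ifs at hn with h
    · exact Finset.mem_filter.mpr ⟨hT n hn, by omega⟩
    · exact absurd hn (lt_irrefl 0)
  have hA1 := signVariations_pair_budget A _ hTA u₁ v₁ h₁ (Finset.mem_filter.mpr ⟨hu₁, by omega⟩)
    (Finset.mem_filter.mpr ⟨hv₁, by omega⟩) (fun m hm1 hm2 => by
      rw [hAc, if_pos (by omega)]; exact hgap₁ m hm1 hm2)
  rw [hAlead, if_pos ha] at hA1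
  have hB1 := signVariations_twoEnded_budget _ B 0 le_rfl (fun m hm => absurd hm (Nat.not_lt_zero m))
    (by rw [hB0c]; exact hb)
  have hB2 : (negSupp B).card ≤ (T.filter (fun n => ¬ n ≤ u₂)).card := by
    refine Finset.card_le_card_of_injOn (fun n => v₂ + n) (fun n hn => ?_) (fun a _ b _ hab => by simpa using hab)
    rw [Finset.mem_coe] at hn
    simp only [negSupp, Finset.mem_filter] at hn
    rw [Finset.mem_coe, Finset.mem_filter]
    exact ⟨hT _ (hBneg n hn.2), by dsimp only; omega⟩
  have hsum : (T.filter (fun n => n ≤ u₂)).card + (T.filter (fun n => ¬ n ≤ u₂)).card = T.card :=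
    Finset.card_filter_add_card_filter_not _
  rw [hsplit, hPlead]
  omega

/-- Root form of the budgets: distinct positive roots are at most the sign variations. [folklore] -/
theorem card_posRoots_le_signVariations (P : ℝ[X]) :
    (P.roots.toFinset.filter (fun t => 0 < t)).card ≤ P.signVariations := by
  have h1 : (P.roots.toFinset.filter (fun t => 0 < t)).card ≤ P.roots.countP (fun t => 0 < t) := by
    rw [← Multiset.toFinset_filter, Multiset.countP_eq_card_filter]
    exact Multiset.toFinset_card_le _
  exact h1.trans P.roots_countP_pos_le_signVariations

end WLawTwoChambers

end Summit.ValiantsHypothesis.ValiantsHypothesis.Theorems.LacunarySymmetroidMatrixDescartes
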